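import Literature.MathematicalPhysics.QuantumFieldTheory.Balaban1983to89.B9Ineq369CurvatureSmall

/-!
# `Balaban1983to89.B9Eq373DerivativeRemainderL2` — T. Bałaban, *Propagators for lattice gauge theories in a background field*, Commun. Math.
# Phys. **99** (1985) 389–434 [Balaban1985BackgroundPropagators] (3.70)–(3.73) pp. 404–405 (with (3.3)/(3.4) p. 391, (3.8)–(3.10) p. 392,
# (3.23) p. 394): THE LOCAL REMAINDERS `V₁(A)`, `V₃(A)` OF THE DIFFERENTIAL LETTERS `D_U`, `D*_U`, `D*_U D_U` (bond curl) AND `Δ^η_U = D*_U D_U`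
# (gauge parameters) AGAINST THE FLAT ONES, AS CRUDE OPERATOR BOUNDS ON THE pub-balaban NE9 CHAIN'S WEIGHTED `L²` SPACES — transporters
# `εR`-close to the identity on the fibre give remainders `O(εR)` with constants explicit in `d` and the scalar `c = η⁻¹`

statement-level skeleton of published theorems with citation tags; proofs where landed; nothing here is a claim about the Yang–Mills mass gap

PDF held: `paper:balaban1985-cmp99-background-propagators` (journal page = PDF page + 388), pp. 391–392, 404–405, 407 read by this seat
(2026-08-22) in the held text.

THE PRINT (verbatim).  p. 404–405, (3.70)–(3.71): *«(D_{U′U}A′)_{μν}(x) = (D_U A′)_{μν}(x) + η⁻¹(exp ηi ad A_μ(x) − 1)R(U(x, x+ηe_μ))A′_ν(x+ηe_μ) − … =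
(D*DA′)_μ(x) − (V₁(A)A′)_μ(x)»*; (3.73): *«The operator V₁ satisfies |(V₁(A)A′)(b)| ≤ O(1)(…)(|A||A′| + …) … The constant O(1) is an absolute
constant depending on d only.»*; p. 407, (3.82): *«Δ_a(U′U) = … = Δ_a(U) − V₃(A) − P₁(A) − P₂(A). The operator V₃(A) is a local differential
operator of the first order satisfying the bound (3.73).»*

WHY THIS FILE (cell context).  Second input of the pub-balaban NE9 owner's gen-80 junction `B9Thm311SmallFieldCoercivity` ([B9] Thm 3.11's
second half at a fixed lattice for the chain's principal gauge-fixed operator): the `D*D`-part of the remainder and the letters `D`, `D*`, `Δ^η_U`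
entering the `R`-part (`B9Eq368ProjectionRemainder`).  The chain's operators are `B11Eq103H1Complex.covDerivL2K`/`covDivL2K`/`covLaplaceSiteK` and
`B9Eq310HessianOperator.covCurlL2K`/`covCoCurlL2K` (whose composite IS `principalOpK`, `principalOpK_eq_comp`) with ABSTRACT transporter data
`R, S : Bond → (W →ₗ W)`; here `R` is `εR`-close to the identity (`‖R(b)w − w‖ ≤ εR‖w‖` — for `R(U(b))X = U(b)XU(b)⁻¹` this is `O(‖U(b) − 1‖)`,
`B9Thm311SmallFieldCoercivity` §4) and compared with a flat pair `R₁, S₁` acting as identities; `D* = D†` for mutually adjoint data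
(`adjoint_covDerivL2K`, `adjoint_covCurlL2K`), so the `D*`/cocurl bounds are the adjoints of the `D`/curl bounds.

WHAT IS PROVED (sorry-free; no `Prop` placeholder; no inequality of the paper asserted as a hypothesis-free fact).
* §0 `norm_le_of_sum_sq_le` (weighted `L²` comparison), **`norm_adjoint_apply_le`** (a pointwise bound `‖Tx‖ ≤ C‖x‖` transfers to `T†`).
* §1 `sum_bond_btgt`/`sum_bond_bpos` (`Σ_b g(b_±) = d·Σ_x g(x)`), `norm_transport_le`, **`norm_covDerivL2K_sub_le`** (`‖(D_R − D_{R₁})f‖ ≤ ‖c‖εR√d‖f‖`),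
  `norm_covDerivL2K_le` (`≤ 2(1+εR)‖c‖√d‖f‖`), `norm_covDivL2K_sub_le`/`norm_covDivL2K_le` (adjoints), **`norm_covLaplaceSiteK_sub_le`**
  (`‖(Δ_{R,S} − Δ_{R₁,S₁})λ‖ ≤ 2(2+εR)‖c‖²d·εR‖λ‖`), `norm_covLaplaceSiteK_le` (`≤ 4(1+εR)²‖c‖²d‖λ‖`).
* §2 `sum_plaq_edge_le` (`B9Ineq369CurvatureSmall.sum_edge_le` with the weight), `norm_covCurl_sub_apply_le`/`norm_covCurl_apply_le` (pointwise, the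
  factor `R(b) − 1` sits on the two transported edges of `∂p`), `norm_plaq_le_of_edge_bound`, **`norm_covCurlL2K_sub_le`** (`4√d‖c‖εR`),
  `norm_covCurlL2K_le`, **`norm_principal_sub_le`** (`‖(D*_S D_R − D*_{S₁}D_{R₁})A‖ ≤ 16d(2+εR)‖c‖²εR‖A‖`), `norm_covCoCurlL2K_le`.
MODEL / DECLARED READINGS.  (M1) as `B9Eq310HessianOperator`/`B11Eq103H1Complex`: periodic lattice `TSite d Pd`, fibre `W` (a `𝕜`-inner product
space), uniform weight `c₀`, scalar `c`; transporter data `R`, `S` abstract.  (M2) hypotheses: `εR ≥ 0`, `‖R(b)w − w‖ ≤ εR‖w‖`, the flat pair acts as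
identities, `conj c = c`, mutual adjointness `⟪R(b)v, u⟫ = ⟪v, S(b)u⟫` for the `D*`/cocurl statements.  (M3) the constants `√d`, `4√d`, `16d`, `2(2+εR)`
are this file's witnesses for print's `O(1)` (crude: print has `2(d−1)` plaquettes per bond); pointwise (sup-norm) forms of (3.69)–(3.73) are
lit-balaban's `B9Eq310Hermitian`/`B9Eq373V3`, not restated.
HONEST SCOPE.  Elementary bookkeeping on the chain's OWN lattice operators; no estimate of the papers at its printed strength (no `|A|²`-terms, no
analyticity, no uniformity beyond the explicit constants); NOT summit progress (cell pub-balaban: NE9 NOT PRINTED / NOT PROVED; spine PROVED 0/9).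
Filed by the pub-balaban NE9 BINDER-row owner lineage `b2b-balaban-t4-ne9-p1` (gen 80); NEW file importing `B9Ineq369CurvatureSmall` only; nothing
modified.  Net new unproved facts: 0.
-/

noncomputable section

open scoped InnerProductSpace ComplexConjugate BigOperators
open Finset

namespace Literature.MathematicalPhysics.QuantumFieldTheory.Balaban1983to89.B9Eq373DerivativeRemainderL2

open B9SectCLatticeCarrier (Bond DirPair shift unshift bpos btgt)
open B4Sect5Torus (TSite)
open B9Eq311L2Pairing (WL2)
open B11Eq103H1Complex (SiteL2K BondL2K covDerivL2K covDivL2K covLaplaceSiteK equiv_covDerivL2K adjoint_covDerivL2K)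
open B9Eq310HessianOperator (PlaqL2K covCurlL2K covCoCurlL2K equiv_covCurlL2K adjoint_covCurlL2K)
open B9Eq33CovDerivVector (covDeriv_apply shiftEquiv)
open B9Eq34CovCurlVector (covCurl_apply_coord)
open B9Ineq369CurvatureSmall (edgeBond sum_edge_le)

/-! ## §0 Two tools: an `L²` comparison lemma and the adjoint transfer of a pointwise bound -/

section Tools

variable {𝕜 : Type*} [RCLike 𝕜]

section L2
variable {X X' V V' : Type*} [Fintype X] [Fintype X'] [NormedAddCommGroup V] [InnerProductSpace 𝕜 V]
  [NormedAddCommGroup V'] [InnerProductSpace 𝕜 V'] {w : X → ℝ} {w' : X' → ℝ} [Fact (∀ x, 0 < w x)] [Fact (∀ x, 0 < w' x)]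

/-- `‖g‖ ≤ C‖f‖` in the weighted `L²` spaces from the comparison of the weighted sums of squares. [folklore]
[cite: Balaban1985BackgroundPropagators, (3.11) p.392] -/
theorem norm_le_of_sum_sq_le (f : WL2 𝕜 w V) (g : WL2 𝕜 w' V') {C : ℝ} (hC : 0 ≤ C)
    (h : ∑ i, w' i * ‖WL2.equiv 𝕜 w' V' g i‖ ^ 2 ≤ C ^ 2 * ∑ x, w x * ‖WL2.equiv 𝕜 w V f x‖ ^ 2) : ‖g‖ ≤ C * ‖f‖ := by
  rw [← WL2.norm_sq, ← WL2.norm_sq, ← mul_pow] at h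
  exact (pow_le_pow_iff_left₀ (norm_nonneg _) (by positivity) two_ne_zero).1 h

end L2

section Adjoint
variable {E F : Type*} [NormedAddCommGroup E] [InnerProductSpace 𝕜 E] [FiniteDimensional 𝕜 E]
  [NormedAddCommGroup F] [InnerProductSpace 𝕜 F] [FiniteDimensional 𝕜 F]

/-- **A pointwise bound transfers to the adjoint**: `‖Tx‖ ≤ C‖x‖` for all `x` gives `‖T†y‖ ≤ C‖y‖` for all `y`
(`‖T†y‖² = re⟪y, T T†y⟫ ≤ C‖y‖‖T†y‖`). [folklore] [cite: Balaban1985BackgroundPropagators, (3.8) p.392] -/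
theorem norm_adjoint_apply_le (T : E →ₗ[𝕜] F) {C : ℝ} (hC : 0 ≤ C) (hT : ∀ x, ‖T x‖ ≤ C * ‖x‖) (y : F) :
    ‖LinearMap.adjoint T y‖ ≤ C * ‖y‖ := by
  have h1 : ‖LinearMap.adjoint T y‖ ^ 2 ≤ C * ‖y‖ * ‖LinearMap.adjoint T y‖ := by
    rw [← inner_self_eq_norm_sq (𝕜 := 𝕜), LinearMap.adjoint_inner_left]
    calc RCLike.re ⟪y, T (LinearMap.adjoint T y)⟫_𝕜 ≤ ‖y‖ * ‖T (LinearMap.adjoint T y)‖ := re_inner_le_norm _ _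
      _ ≤ ‖y‖ * (C * ‖LinearMap.adjoint T y‖) := mul_le_mul_of_nonneg_left (hT _) (norm_nonneg _)
      _ = C * ‖y‖ * ‖LinearMap.adjoint T y‖ := by ring
  rcases eq_or_lt_of_le (norm_nonneg (LinearMap.adjoint T y)) with h0 | hpos
  · rw [← h0]; positivity
  · have : ‖LinearMap.adjoint T y‖ * ‖LinearMap.adjoint T y‖ ≤ (C * ‖y‖) * ‖LinearMap.adjoint T y‖ := by nlinarith
    exact le_of_mul_le_mul_right this hpos

end Adjoint

end Tools

/-! ## §1 The covariant derivative `D` ((3.3)): bound and remainder against the flat `∂` on the `L²` spaces -/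

section Deriv

variable {𝕜 : Type*} [RCLike 𝕜] {d : ℕ} {Pd : Fin d → ℕ} {W : Type*} [NormedAddCommGroup W] [InnerProductSpace 𝕜 W]
  {c₀ : ℝ} [Fact (0 < c₀)] (c : 𝕜)
  {R R₁ : Bond d Pd → W →ₗ[𝕜] W} {εR : ℝ}

omit [Fact (0 < c₀)] in
/-- `Σ_b g(b₊) = d·Σ_x g(x)` (each unit step is a permutation of the periodic lattice). [folklore] [cite: Balaban1985BackgroundPropagators, (3.3) p.391] -/
theorem sum_bond_btgt (g : TSite d Pd → ℝ) : ∑ b : Bond d Pd, g (btgt b) = d * ∑ x, g x := by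
  rw [Fintype.sum_prod_type, Finset.sum_comm]
  have h : ∀ μ : Fin d, ∑ x : TSite d Pd, g (shift μ x) = ∑ x, g x := fun μ => Equiv.sum_comp (shiftEquiv μ) g
  simp_rw [btgt, h, Finset.sum_const, Finset.card_univ, Fintype.card_fin, nsmul_eq_mul]

omit [Fact (0 < c₀)] in
/-- `Σ_b g(b₋) = d·Σ_x g(x)`. [folklore] [cite: Balaban1985BackgroundPropagators, (3.3) p.391] -/
theorem sum_bond_bpos (g : TSite d Pd → ℝ) : ∑ b : Bond d Pd, g (bpos b) = d * ∑ x, g x := by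
  rw [Fintype.sum_prod_type, Finset.sum_comm]
  simp_rw [bpos, Finset.sum_const, Finset.card_univ, Fintype.card_fin, nsmul_eq_mul]

/-- **THE REMAINDER OF `D_U` AGAINST THE FLAT `∂` ON `L²`** — the first-order term of (3.70) at the level of a crude bound: if every transporter is
`εR`-close to the identity on the fibre (`‖R(b)w − w‖ ≤ εR‖w‖`; print: `R(U′) = exp(ηi ad A) = 1 + O(α₁)`) and `R₁` acts as the identity, then
`‖(D_R − D_{R₁})f‖ ≤ ‖c‖·εR·√d·‖f‖`. [cite: Balaban1985BackgroundPropagators, (3.70)–(3.71) pp.404–405, (3.73) p.405] -/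
theorem norm_covDerivL2K_sub_le (hεR : 0 ≤ εR) (hR : ∀ b w, ‖R b w - w‖ ≤ εR * ‖w‖) (hR₁ : ∀ b w, R₁ b w = w)
    (f : SiteL2K 𝕜 d Pd c₀ W) :
    ‖covDerivL2K 𝕜 c₀ c R f - covDerivL2K 𝕜 c₀ c R₁ f‖ ≤ ‖c‖ * εR * Real.sqrt d * ‖f‖ := by
  have hc₀ : 0 < c₀ := Fact.out
  refine norm_le_of_sum_sq_le f _ (by positivity) ?_
  have hpt : ∀ b : Bond d Pd, c₀ * ‖WL2.equiv 𝕜 _ W (covDerivL2K 𝕜 c₀ c R f - covDerivL2K 𝕜 c₀ c R₁ f) b‖ ^ 2 ≤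
      (‖c‖ * εR) ^ 2 * (c₀ * ‖WL2.equiv 𝕜 _ W f (btgt b)‖ ^ 2) := fun b => by
    rw [WL2.equiv_sub, Pi.sub_apply, equiv_covDerivL2K, equiv_covDerivL2K, covDeriv_apply, covDeriv_apply, hR₁, ← smul_sub,
      sub_sub_sub_cancel_right, norm_smul]
    have h := hR b (WL2.equiv 𝕜 _ W f (btgt b))
    have : (‖c‖ * ‖R b (WL2.equiv 𝕜 _ W f (btgt b)) - WL2.equiv 𝕜 _ W f (btgt b)‖) ^ 2 ≤ (‖c‖ * (εR * ‖WL2.equiv 𝕜 _ W f (btgt b)‖)) ^ 2 := by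
      gcongr
    nlinarith [hc₀.le]
  calc ∑ b : Bond d Pd, c₀ * ‖WL2.equiv 𝕜 _ W (covDerivL2K 𝕜 c₀ c R f - covDerivL2K 𝕜 c₀ c R₁ f) b‖ ^ 2
      ≤ ∑ b : Bond d Pd, (‖c‖ * εR) ^ 2 * (c₀ * ‖WL2.equiv 𝕜 _ W f (btgt b)‖ ^ 2) := sum_le_sum fun b _ => hpt b
    _ = (‖c‖ * εR) ^ 2 * (d * ∑ x : TSite d Pd, c₀ * ‖WL2.equiv 𝕜 _ W f x‖ ^ 2) := by
        rw [← mul_sum, sum_bond_btgt (fun x => c₀ * ‖WL2.equiv 𝕜 _ W f x‖ ^ 2)]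
    _ = (‖c‖ * εR * Real.sqrt d) ^ 2 * ∑ x : TSite d Pd, c₀ * ‖WL2.equiv 𝕜 _ W f x‖ ^ 2 := by
        rw [mul_pow (‖c‖ * εR), Real.sq_sqrt (Nat.cast_nonneg d)]; ring

/-- `‖R(b)w‖ ≤ (1 + εR)‖w‖`. [folklore] [cite: Balaban1985BackgroundPropagators, (3.70) p.404] -/
theorem norm_transport_le (hR : ∀ b w, ‖R b w - w‖ ≤ εR * ‖w‖) (b : Bond d Pd) (w : W) : ‖R b w‖ ≤ (1 + εR) * ‖w‖ := by
  calc ‖R b w‖ = ‖(R b w - w) + w‖ := by rw [sub_add_cancel]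
    _ ≤ ‖R b w - w‖ + ‖w‖ := norm_add_le _ _
    _ ≤ εR * ‖w‖ + ‖w‖ := by linarith [hR b w]
    _ = (1 + εR) * ‖w‖ := by ring

/-- **THE BOUND OF `D_U` ON `L²`**: `‖D_R f‖ ≤ 2(1 + εR)·‖c‖·√d·‖f‖` when `‖R(b)w − w‖ ≤ εR‖w‖`. [cite: Balaban1985BackgroundPropagators, (3.3) p.391, (3.73) p.405] -/
theorem norm_covDerivL2K_le (hεR : 0 ≤ εR) (hR : ∀ b w, ‖R b w - w‖ ≤ εR * ‖w‖) (f : SiteL2K 𝕜 d Pd c₀ W) :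
    ‖covDerivL2K 𝕜 c₀ c R f‖ ≤ 2 * (1 + εR) * ‖c‖ * Real.sqrt d * ‖f‖ := by
  have hc₀ : 0 < c₀ := Fact.out
  refine norm_le_of_sum_sq_le f _ (by positivity) ?_
  set F : TSite d Pd → W := WL2.equiv 𝕜 _ W f with hF
  have hpt : ∀ b : Bond d Pd, c₀ * ‖WL2.equiv 𝕜 _ W (covDerivL2K 𝕜 c₀ c R f) b‖ ^ 2 ≤
      2 * ((1 + εR) * ‖c‖) ^ 2 * (c₀ * ‖F (btgt b)‖ ^ 2) + 2 * ((1 + εR) * ‖c‖) ^ 2 * (c₀ * ‖F (bpos b)‖ ^ 2) := fun b => by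
    rw [equiv_covDerivL2K, covDeriv_apply, norm_smul]
    have h1 : ‖R b (F (btgt b)) - F (bpos b)‖ ≤ (1 + εR) * ‖F (btgt b)‖ + (1 + εR) * ‖F (bpos b)‖ := by
      calc ‖R b (F (btgt b)) - F (bpos b)‖ ≤ ‖R b (F (btgt b))‖ + ‖F (bpos b)‖ := norm_sub_le _ _
        _ ≤ (1 + εR) * ‖F (btgt b)‖ + (1 + εR) * ‖F (bpos b)‖ := by
            refine add_le_add (norm_transport_le hR b _) ?_
            nlinarith [norm_nonneg (F (bpos b))]
    have h2 : (‖c‖ * ‖R b (F (btgt b)) - F (bpos b)‖) ^ 2 ≤ (‖c‖ * ((1 + εR) * ‖F (btgt b)‖ + (1 + εR) * ‖F (bpos b)‖)) ^ 2 := by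
      gcongr
    have h3 : ((1 + εR) * ‖F (btgt b)‖ + (1 + εR) * ‖F (bpos b)‖) ^ 2 ≤
        2 * ((1 + εR) * ‖F (btgt b)‖) ^ 2 + 2 * ((1 + εR) * ‖F (bpos b)‖) ^ 2 := by
      nlinarith [sq_nonneg ((1 + εR) * ‖F (btgt b)‖ - (1 + εR) * ‖F (bpos b)‖)]
    nlinarith [hc₀.le, mul_nonneg hc₀.le (sq_nonneg ‖c‖)]
  calc ∑ b : Bond d Pd, c₀ * ‖WL2.equiv 𝕜 _ W (covDerivL2K 𝕜 c₀ c R f) b‖ ^ 2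
      ≤ ∑ b : Bond d Pd, (2 * ((1 + εR) * ‖c‖) ^ 2 * (c₀ * ‖F (btgt b)‖ ^ 2) + 2 * ((1 + εR) * ‖c‖) ^ 2 * (c₀ * ‖F (bpos b)‖ ^ 2)) :=
        sum_le_sum fun b _ => hpt b
    _ = 2 * ((1 + εR) * ‖c‖) ^ 2 * (d * ∑ x : TSite d Pd, c₀ * ‖F x‖ ^ 2) + 2 * ((1 + εR) * ‖c‖) ^ 2 * (d * ∑ x : TSite d Pd, c₀ * ‖F x‖ ^ 2) := by
        rw [sum_add_distrib, ← mul_sum univ (fun b => c₀ * ‖F (btgt b)‖ ^ 2) (2 * ((1 + εR) * ‖c‖) ^ 2),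
          ← mul_sum univ (fun b => c₀ * ‖F (bpos b)‖ ^ 2) (2 * ((1 + εR) * ‖c‖) ^ 2),
          sum_bond_btgt (fun x => c₀ * ‖F x‖ ^ 2), sum_bond_bpos (fun x => c₀ * ‖F x‖ ^ 2)]
    _ = (2 * (1 + εR) * ‖c‖ * Real.sqrt d) ^ 2 * ∑ x : TSite d Pd, c₀ * ‖F x‖ ^ 2 := by
        rw [mul_pow (2 * (1 + εR) * ‖c‖), Real.sq_sqrt (Nat.cast_nonneg d)]; ring

variable [FiniteDimensional 𝕜 W] {S S₁ : Bond d Pd → W →ₗ[𝕜] W}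

/-- **`D*` ((3.8)) INHERITS BOTH BOUNDS BY ADJOINTNESS**: for `conj c = c` and mutually adjoint transporter data (`⟪R(b)v, u⟫ = ⟪v, S(b)u⟫`,
likewise for the flat pair `R₁, S₁` acting as identities) `D*_S = D_R†`, so `‖(D*_S − D*_{S₁})A‖ ≤ ‖c‖·εR·√d·‖A‖` and
`‖D*_S A‖ ≤ 2(1 + εR)·‖c‖·√d·‖A‖`. [cite: Balaban1985BackgroundPropagators, (3.8) p.392, (3.71) p.405] -/
theorem norm_covDivL2K_sub_le (hc : conj c = c) (hεR : 0 ≤ εR) (hR : ∀ b w, ‖R b w - w‖ ≤ εR * ‖w‖) (hR₁ : ∀ b w, R₁ b w = w)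
    (hRS : ∀ (b : Bond d Pd) (v u : W), ⟪R b v, u⟫_𝕜 = ⟪v, S b u⟫_𝕜) (hS₁ : ∀ b w, S₁ b w = w) (A : BondL2K 𝕜 d Pd c₀ W) :
    ‖covDivL2K 𝕜 c₀ c S A - covDivL2K 𝕜 c₀ c S₁ A‖ ≤ ‖c‖ * εR * Real.sqrt d * ‖A‖ := by
  have hR₁S₁ : ∀ (b : Bond d Pd) (v u : W), ⟪R₁ b v, u⟫_𝕜 = ⟪v, S₁ b u⟫_𝕜 := fun b v u => by rw [hR₁, hS₁]
  rw [← adjoint_covDerivL2K c hc R S hRS, ← adjoint_covDerivL2K c hc R₁ S₁ hR₁S₁, ← LinearMap.sub_apply, ← map_sub]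
  exact norm_adjoint_apply_le _ (by positivity) (fun f => by rw [LinearMap.sub_apply]; exact norm_covDerivL2K_sub_le c hεR hR hR₁ f) A

/-- `‖D*_S A‖ ≤ 2(1 + εR)·‖c‖·√d·‖A‖`. [cite: Balaban1985BackgroundPropagators, (3.8) p.392] -/
theorem norm_covDivL2K_le (hc : conj c = c) (hεR : 0 ≤ εR) (hR : ∀ b w, ‖R b w - w‖ ≤ εR * ‖w‖)
    (hRS : ∀ (b : Bond d Pd) (v u : W), ⟪R b v, u⟫_𝕜 = ⟪v, S b u⟫_𝕜) (A : BondL2K 𝕜 d Pd c₀ W) :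
    ‖covDivL2K 𝕜 c₀ c S A‖ ≤ 2 * (1 + εR) * ‖c‖ * Real.sqrt d * ‖A‖ := by
  rw [← adjoint_covDerivL2K c hc R S hRS]
  exact norm_adjoint_apply_le _ (by positivity) (norm_covDerivL2K_le c hεR hR) A

/-- **THE REMAINDER OF THE COVARIANT LAPLACIAN `Δ^η_U = D*_U D_U` ((3.23)) ON THE GAUGE PARAMETERS AGAINST THE FLAT ONE**:
`‖(Δ_{R,S} − Δ_{R₁,S₁})λ‖ ≤ 2(2 + εR)·‖c‖²·d·εR·‖λ‖` (`= D*_S(D_R − D_{R₁}) + (D*_S − D*_{S₁})D_{R₁}`). [cite: Balaban1985BackgroundPropagators, (3.23) p.394, (3.71)–(3.73) p.405] -/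
theorem norm_covLaplaceSiteK_sub_le (hc : conj c = c) (hεR : 0 ≤ εR) (hR : ∀ b w, ‖R b w - w‖ ≤ εR * ‖w‖) (hR₁ : ∀ b w, R₁ b w = w)
    (hRS : ∀ (b : Bond d Pd) (v u : W), ⟪R b v, u⟫_𝕜 = ⟪v, S b u⟫_𝕜) (hS₁ : ∀ b w, S₁ b w = w) (l : SiteL2K 𝕜 d Pd c₀ W) :
    ‖covLaplaceSiteK c R S l - covLaplaceSiteK c R₁ S₁ l‖ ≤ 2 * (2 + εR) * ‖c‖ ^ 2 * d * εR * ‖l‖ := by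
  have hR₁' : ∀ b w, ‖R₁ b w - w‖ ≤ 0 * ‖w‖ := fun b w => by rw [hR₁, sub_self, norm_zero, zero_mul]
  have hsplit : covLaplaceSiteK c R S l - covLaplaceSiteK c R₁ S₁ l =
      covDivL2K 𝕜 c₀ c S (covDerivL2K 𝕜 c₀ c R l - covDerivL2K 𝕜 c₀ c R₁ l) +
        (covDivL2K 𝕜 c₀ c S (covDerivL2K 𝕜 c₀ c R₁ l) - covDivL2K 𝕜 c₀ c S₁ (covDerivL2K 𝕜 c₀ c R₁ l)) := by
    simp only [covLaplaceSiteK, LinearMap.comp_apply, map_sub]; abel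
  have h1 := norm_covDivL2K_le c hc hεR hR hRS (covDerivL2K 𝕜 c₀ c R l - covDerivL2K 𝕜 c₀ c R₁ l)
  have h2 := norm_covDerivL2K_sub_le c hεR hR hR₁ l
  have h3 := norm_covDivL2K_sub_le c hc hεR hR hR₁ hRS hS₁ (covDerivL2K 𝕜 c₀ c R₁ l)
  have h4 := norm_covDerivL2K_le c le_rfl hR₁' l
  have hd : Real.sqrt d * Real.sqrt d = d := Real.mul_self_sqrt (Nat.cast_nonneg d)
  rw [hsplit]
  calc _ ≤ ‖covDivL2K 𝕜 c₀ c S (covDerivL2K 𝕜 c₀ c R l - covDerivL2K 𝕜 c₀ c R₁ l)‖ +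
        ‖covDivL2K 𝕜 c₀ c S (covDerivL2K 𝕜 c₀ c R₁ l) - covDivL2K 𝕜 c₀ c S₁ (covDerivL2K 𝕜 c₀ c R₁ l)‖ := norm_add_le _ _
    _ ≤ 2 * (1 + εR) * ‖c‖ * Real.sqrt d * (‖c‖ * εR * Real.sqrt d * ‖l‖) +
        ‖c‖ * εR * Real.sqrt d * (2 * (1 + 0) * ‖c‖ * Real.sqrt d * ‖l‖) :=
        add_le_add (h1.trans (mul_le_mul_of_nonneg_left h2 (by positivity))) (h3.trans (mul_le_mul_of_nonneg_left h4 (by positivity)))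
    _ = 2 * (2 + εR) * ‖c‖ ^ 2 * (Real.sqrt d * Real.sqrt d) * εR * ‖l‖ := by ring
    _ = 2 * (2 + εR) * ‖c‖ ^ 2 * d * εR * ‖l‖ := by rw [hd]

/-- **THE BOUND OF `Δ^η_U` ON `L²`**: `‖Δ_{R,S}λ‖ ≤ 4(1 + εR)²·‖c‖²·d·‖λ‖`. [cite: Balaban1985BackgroundPropagators, (3.23) p.394] -/
theorem norm_covLaplaceSiteK_le (hc : conj c = c) (hεR : 0 ≤ εR) (hR : ∀ b w, ‖R b w - w‖ ≤ εR * ‖w‖)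
    (hRS : ∀ (b : Bond d Pd) (v u : W), ⟪R b v, u⟫_𝕜 = ⟪v, S b u⟫_𝕜) (l : SiteL2K 𝕜 d Pd c₀ W) :
    ‖covLaplaceSiteK c R S l‖ ≤ 4 * (1 + εR) ^ 2 * ‖c‖ ^ 2 * d * ‖l‖ := by
  have h1 := norm_covDivL2K_le c hc hεR hR hRS (covDerivL2K 𝕜 c₀ c R l)
  have h2 := norm_covDerivL2K_le c hεR hR l
  have hd : Real.sqrt d * Real.sqrt d = d := Real.mul_self_sqrt (Nat.cast_nonneg d)
  calc ‖covLaplaceSiteK c R S l‖ = ‖covDivL2K 𝕜 c₀ c S (covDerivL2K 𝕜 c₀ c R l)‖ := rfl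
    _ ≤ 2 * (1 + εR) * ‖c‖ * Real.sqrt d * (2 * (1 + εR) * ‖c‖ * Real.sqrt d * ‖l‖) := h1.trans (mul_le_mul_of_nonneg_left h2 (by positivity))
    _ = 4 * (1 + εR) ^ 2 * ‖c‖ ^ 2 * (Real.sqrt d * Real.sqrt d) * ‖l‖ := by ring
    _ = 4 * (1 + εR) ^ 2 * ‖c‖ ^ 2 * d * ‖l‖ := by rw [hd]

end Deriv

/-! ## §2 The curl `D` on bond functions ((3.4)) and the principal part `D*D` of (3.10): bound and remainder -/

section Curl

variable {𝕜 : Type*} [RCLike 𝕜] {d : ℕ} {Pd : Fin d → ℕ} {W : Type*} [NormedAddCommGroup W] [InnerProductSpace 𝕜 W]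
  {c₀ : ℝ} [Fact (0 < c₀)] (c : 𝕜)
  {R R₁ : Bond d Pd → W →ₗ[𝕜] W} {εR : ℝ}

omit [Fact (0 < c₀)] in
/-- `Σ_p Σ_{k<4} g(e_k(p))·c₀ ≤ 4d·Σ_b c₀ g(b)` for `g ≥ 0` — `B9Ineq369CurvatureSmall.sum_edge_le` with the weight. [folklore]
[cite: Balaban1985BackgroundPropagators, (3.69) p.404] -/
theorem sum_plaq_edge_le {g : Bond d Pd → ℝ} (hg : ∀ b, 0 ≤ g b) (hc₀ : 0 ≤ c₀) :
    ∑ p : B9SectCLatticeCarrier.Plaq d Pd, ∑ k : Fin 4, c₀ * g (edgeBond p k) ≤ 4 * d * ∑ b : Bond d Pd, c₀ * g b := by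
  have h := sum_edge_le (d := d) (Pd := Pd) (g := fun b => c₀ * g b) fun b => mul_nonneg hc₀ (hg b)
  rw [← Fintype.sum_prod_type'] 
  exact h

/-- pointwise: the curl difference at a plaquette carries a factor `R(b) − 1` on the two transported edges `e₀`, `e₃`. [folklore]
[cite: Balaban1985BackgroundPropagators, (3.70) p.404] -/
theorem norm_covCurl_sub_apply_le (hεR : 0 ≤ εR) (hR : ∀ b w, ‖R b w - w‖ ≤ εR * ‖w‖) (hR₁ : ∀ b w, R₁ b w = w)
    (A : Bond d Pd → W) (p : B9SectCLatticeCarrier.Plaq d Pd) :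
    ‖B9Eq34CovCurlVector.covCurl c R A p - B9Eq34CovCurlVector.covCurl c R₁ A p‖ ≤ ‖c‖ * εR * ∑ k : Fin 4, ‖A (edgeBond p k)‖ := by
  obtain ⟨x, q⟩ := p
  rw [covCurl_apply_coord, covCurl_apply_coord, hR₁, hR₁]
  have hsplit : c • (R (x, q.1.1) (A (shift q.1.1 x, q.1.2)) - A (x, q.1.2)) - c • (R (x, q.1.2) (A (shift q.1.2 x, q.1.1)) - A (x, q.1.1)) -
      (c • (A (shift q.1.1 x, q.1.2) - A (x, q.1.2)) - c • (A (shift q.1.2 x, q.1.1) - A (x, q.1.1))) =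
      c • (R (x, q.1.1) (A (shift q.1.1 x, q.1.2)) - A (shift q.1.1 x, q.1.2)) - c • (R (x, q.1.2) (A (shift q.1.2 x, q.1.1)) - A (shift q.1.2 x, q.1.1)) := by
    simp only [smul_sub]; abel
  rw [hsplit]
  have h0 := hR (x, q.1.2) (A (shift q.1.2 x, q.1.1))
  have h3 := hR (x, q.1.1) (A (shift q.1.1 x, q.1.2))
  have hsum : ∑ k : Fin 4, ‖A (edgeBond (x, q) k)‖ =
      ‖A (shift q.1.2 x, q.1.1)‖ + ‖A (x, q.1.2)‖ + ‖A (x, q.1.1)‖ + ‖A (shift q.1.1 x, q.1.2)‖ := by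
    simp only [Fin.sum_univ_four, edgeBond, Matrix.cons_val_zero, Matrix.cons_val_one, Matrix.cons_val]
  rw [hsum]
  calc ‖c • (R (x, q.1.1) (A (shift q.1.1 x, q.1.2)) - A (shift q.1.1 x, q.1.2)) - c • (R (x, q.1.2) (A (shift q.1.2 x, q.1.1)) - A (shift q.1.2 x, q.1.1))‖
      ≤ ‖c • (R (x, q.1.1) (A (shift q.1.1 x, q.1.2)) - A (shift q.1.1 x, q.1.2))‖ + ‖c • (R (x, q.1.2) (A (shift q.1.2 x, q.1.1)) - A (shift q.1.2 x, q.1.1))‖ :=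
        norm_sub_le _ _
    _ ≤ ‖c‖ * (εR * ‖A (shift q.1.1 x, q.1.2)‖) + ‖c‖ * (εR * ‖A (shift q.1.2 x, q.1.1)‖) := by
        rw [norm_smul, norm_smul]
        exact add_le_add (mul_le_mul_of_nonneg_left h3 (norm_nonneg _)) (mul_le_mul_of_nonneg_left h0 (norm_nonneg _))
    _ ≤ ‖c‖ * εR * (‖A (shift q.1.2 x, q.1.1)‖ + ‖A (x, q.1.2)‖ + ‖A (x, q.1.1)‖ + ‖A (shift q.1.1 x, q.1.2)‖) := by
        have := mul_nonneg (norm_nonneg c) hεR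
        nlinarith [norm_nonneg (A (x, q.1.2)), norm_nonneg (A (x, q.1.1))]

/-- pointwise: `‖(D_R A)(p)‖ ≤ (1 + εR)·‖c‖·Σ_{b⊂∂p}‖A(b)‖`. [folklore] [cite: Balaban1985BackgroundPropagators, (3.4) p.391] -/
theorem norm_covCurl_apply_le (hεR : 0 ≤ εR) (hR : ∀ b w, ‖R b w - w‖ ≤ εR * ‖w‖) (A : Bond d Pd → W) (p : B9SectCLatticeCarrier.Plaq d Pd) :
    ‖B9Eq34CovCurlVector.covCurl c R A p‖ ≤ (1 + εR) * ‖c‖ * ∑ k : Fin 4, ‖A (edgeBond p k)‖ := by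
  obtain ⟨x, q⟩ := p
  rw [covCurl_apply_coord]
  have hsum : ∑ k : Fin 4, ‖A (edgeBond (x, q) k)‖ =
      ‖A (shift q.1.2 x, q.1.1)‖ + ‖A (x, q.1.2)‖ + ‖A (x, q.1.1)‖ + ‖A (shift q.1.1 x, q.1.2)‖ := by
    simp only [Fin.sum_univ_four, edgeBond, Matrix.cons_val_zero, Matrix.cons_val_one, Matrix.cons_val]
  rw [hsum]
  have h0 := norm_transport_le hR (x, q.1.2) (A (shift q.1.2 x, q.1.1))
  have h3 := norm_transport_le hR (x, q.1.1) (A (shift q.1.1 x, q.1.2))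
  have hε1 : (1 : ℝ) ≤ 1 + εR := by linarith
  calc ‖c • (R (x, q.1.1) (A (shift q.1.1 x, q.1.2)) - A (x, q.1.2)) - c • (R (x, q.1.2) (A (shift q.1.2 x, q.1.1)) - A (x, q.1.1))‖
      ≤ ‖c • (R (x, q.1.1) (A (shift q.1.1 x, q.1.2)) - A (x, q.1.2))‖ + ‖c • (R (x, q.1.2) (A (shift q.1.2 x, q.1.1)) - A (x, q.1.1))‖ :=
        norm_sub_le _ _
    _ ≤ ‖c‖ * (‖R (x, q.1.1) (A (shift q.1.1 x, q.1.2))‖ + ‖A (x, q.1.2)‖) + ‖c‖ * (‖R (x, q.1.2) (A (shift q.1.2 x, q.1.1))‖ + ‖A (x, q.1.1)‖) := by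
        rw [norm_smul, norm_smul]
        exact add_le_add (mul_le_mul_of_nonneg_left (norm_sub_le _ _) (norm_nonneg _)) (mul_le_mul_of_nonneg_left (norm_sub_le _ _) (norm_nonneg _))
    _ ≤ (1 + εR) * ‖c‖ * (‖A (shift q.1.2 x, q.1.1)‖ + ‖A (x, q.1.2)‖ + ‖A (x, q.1.1)‖ + ‖A (shift q.1.1 x, q.1.2)‖) := by
        have hc0 := norm_nonneg c
        have h1 : ‖A (x, q.1.2)‖ ≤ (1 + εR) * ‖A (x, q.1.2)‖ := le_mul_of_one_le_left (norm_nonneg _) hε1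
        have h2 : ‖A (x, q.1.1)‖ ≤ (1 + εR) * ‖A (x, q.1.1)‖ := le_mul_of_one_le_left (norm_nonneg _) hε1
        nlinarith [mul_le_mul_of_nonneg_left (add_le_add (add_le_add h3 h1) (add_le_add h0 h2)) hc0]

/-- from a pointwise plaquette bound `‖G(p)‖ ≤ K·Σ_{b⊂∂p}‖A(b)‖` to the `L²` bound `‖G‖ ≤ 4√d·K·‖A‖`. [folklore]
[cite: Balaban1985BackgroundPropagators, (3.69) p.404, (3.11) p.392] -/
theorem norm_plaq_le_of_edge_bound (A : BondL2K 𝕜 d Pd c₀ W) (G : PlaqL2K 𝕜 d Pd c₀ W) {K : ℝ} (hK : 0 ≤ K)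
    (h : ∀ p : B9SectCLatticeCarrier.Plaq d Pd, ‖WL2.equiv 𝕜 _ W G p‖ ≤ K * ∑ k : Fin 4, ‖WL2.equiv 𝕜 _ W A (edgeBond p k)‖) :
    ‖G‖ ≤ 4 * Real.sqrt d * K * ‖A‖ := by
  have hc₀ : 0 < c₀ := Fact.out
  refine norm_le_of_sum_sq_le A G (by positivity) ?_
  set a : Bond d Pd → W := WL2.equiv 𝕜 _ W A with ha
  have hpt : ∀ p : B9SectCLatticeCarrier.Plaq d Pd, c₀ * ‖WL2.equiv 𝕜 _ W G p‖ ^ 2 ≤ 4 * K ^ 2 * ∑ k : Fin 4, c₀ * ‖a (edgeBond p k)‖ ^ 2 := fun p => by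
    have h1 : ‖WL2.equiv 𝕜 _ W G p‖ ^ 2 ≤ (K * ∑ k : Fin 4, ‖a (edgeBond p k)‖) ^ 2 := by
      have := h p; gcongr
    have h2 : (∑ k : Fin 4, ‖a (edgeBond p k)‖) ^ 2 ≤ 4 * ∑ k : Fin 4, ‖a (edgeBond p k)‖ ^ 2 := by
      have h := sq_sum_le_card_mul_sum_sq (s := (univ : Finset (Fin 4))) (f := fun k => ‖a (edgeBond p k)‖)
      simpa using h
    rw [mul_sum]
    calc c₀ * ‖WL2.equiv 𝕜 _ W G p‖ ^ 2 ≤ c₀ * (K ^ 2 * (4 * ∑ k : Fin 4, ‖a (edgeBond p k)‖ ^ 2)) := by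
          refine mul_le_mul_of_nonneg_left (h1.trans ?_) hc₀.le
          rw [mul_pow]; exact mul_le_mul_of_nonneg_left h2 (sq_nonneg _)
      _ = ∑ k : Fin 4, 4 * K ^ 2 * (c₀ * ‖a (edgeBond p k)‖ ^ 2) := by rw [mul_sum, mul_sum, mul_sum]; exact sum_congr rfl fun k _ => by ring
  calc ∑ p : B9SectCLatticeCarrier.Plaq d Pd, c₀ * ‖WL2.equiv 𝕜 _ W G p‖ ^ 2 ≤ ∑ p : B9SectCLatticeCarrier.Plaq d Pd, 4 * K ^ 2 * ∑ k : Fin 4, c₀ * ‖a (edgeBond p k)‖ ^ 2 :=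
        sum_le_sum fun p _ => hpt p
    _ = 4 * K ^ 2 * ∑ p : B9SectCLatticeCarrier.Plaq d Pd, ∑ k : Fin 4, c₀ * ‖a (edgeBond p k)‖ ^ 2 := by rw [← mul_sum]
    _ ≤ 4 * K ^ 2 * (4 * d * ∑ b : Bond d Pd, c₀ * ‖a b‖ ^ 2) :=
        mul_le_mul_of_nonneg_left (sum_plaq_edge_le (g := fun b => ‖a b‖ ^ 2) (fun b => sq_nonneg _) hc₀.le) (by positivity)
    _ = (4 * Real.sqrt d * K) ^ 2 * ∑ b : Bond d Pd, c₀ * ‖a b‖ ^ 2 := by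
        rw [mul_pow, mul_pow, Real.sq_sqrt (Nat.cast_nonneg d)]; ring

/-- **THE REMAINDER OF THE CURL `D_U` ((3.4)) AGAINST THE FLAT CURL ON `L²`**: `‖(D_R − D_{R₁})A‖ ≤ 4√d·‖c‖·εR·‖A‖`.
[cite: Balaban1985BackgroundPropagators, (3.4) p.391, (3.70)–(3.73) pp.404–405] -/
theorem norm_covCurlL2K_sub_le (hεR : 0 ≤ εR) (hR : ∀ b w, ‖R b w - w‖ ≤ εR * ‖w‖) (hR₁ : ∀ b w, R₁ b w = w)
    (A : BondL2K 𝕜 d Pd c₀ W) :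
    ‖covCurlL2K 𝕜 c₀ c R A - covCurlL2K 𝕜 c₀ c R₁ A‖ ≤ 4 * Real.sqrt d * (‖c‖ * εR) * ‖A‖ :=
  norm_plaq_le_of_edge_bound A _ (by positivity) fun p => by
    rw [WL2.equiv_sub, Pi.sub_apply, equiv_covCurlL2K, equiv_covCurlL2K]
    exact norm_covCurl_sub_apply_le c hεR hR hR₁ _ p

/-- **THE BOUND OF THE CURL ON `L²`**: `‖D_R A‖ ≤ 4√d·(1 + εR)·‖c‖·‖A‖`. [cite: Balaban1985BackgroundPropagators, (3.4) p.391] -/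
theorem norm_covCurlL2K_le (hεR : 0 ≤ εR) (hR : ∀ b w, ‖R b w - w‖ ≤ εR * ‖w‖) (A : BondL2K 𝕜 d Pd c₀ W) :
    ‖covCurlL2K 𝕜 c₀ c R A‖ ≤ 4 * Real.sqrt d * ((1 + εR) * ‖c‖) * ‖A‖ :=
  norm_plaq_le_of_edge_bound A _ (by positivity) fun p => by
    rw [equiv_covCurlL2K]
    exact norm_covCurl_apply_le c hεR hR _ p

variable [FiniteDimensional 𝕜 W] {S S₁ : Bond d Pd → W →ₗ[𝕜] W}

/-- **THE REMAINDER OF THE PRINCIPAL PART `D*_U D_U` OF (3.10) AGAINST THE FLAT `∂*∂` ON `L²`** — print's `V₁(A)` of (3.71) at the level of a crude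
operator bound: with `D* = D†` (mutually adjoint transporters, `conj c = c`),
`‖(D*_S D_R − D*_{S₁} D_{R₁})A‖ ≤ 16d·(2 + εR)·‖c‖²·εR·‖A‖`. [cite: Balaban1985BackgroundPropagators, (3.10) p.392, (3.70)–(3.73) pp.404–405] -/
theorem norm_principal_sub_le (hc : conj c = c) (hεR : 0 ≤ εR) (hR : ∀ b w, ‖R b w - w‖ ≤ εR * ‖w‖) (hR₁ : ∀ b w, R₁ b w = w)
    (hRS : ∀ (b : Bond d Pd) (v u : W), ⟪R b v, u⟫_𝕜 = ⟪v, S b u⟫_𝕜) (hS₁ : ∀ b w, S₁ b w = w) (A : BondL2K 𝕜 d Pd c₀ W) :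
    ‖covCoCurlL2K 𝕜 c₀ c S (covCurlL2K 𝕜 c₀ c R A) - covCoCurlL2K 𝕜 c₀ c S₁ (covCurlL2K 𝕜 c₀ c R₁ A)‖ ≤
      16 * d * (2 + εR) * ‖c‖ ^ 2 * εR * ‖A‖ := by
  have hR₁S₁ : ∀ (b : Bond d Pd) (v u : W), ⟪R₁ b v, u⟫_𝕜 = ⟪v, S₁ b u⟫_𝕜 := fun b v u => by rw [hR₁, hS₁]
  have hR₁' : ∀ b w, ‖R₁ b w - w‖ ≤ 0 * ‖w‖ := fun b w => by rw [hR₁, sub_self, norm_zero, zero_mul]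
  -- `D*_S = (D_R)†`, `D*_{S₁} = (D_{R₁})†`
  rw [← adjoint_covCurlL2K c hc R S hRS, ← adjoint_covCurlL2K c hc R₁ S₁ hR₁S₁]
  have hsplit : LinearMap.adjoint (covCurlL2K 𝕜 c₀ c R) (covCurlL2K 𝕜 c₀ c R A) - LinearMap.adjoint (covCurlL2K 𝕜 c₀ c R₁) (covCurlL2K 𝕜 c₀ c R₁ A) =
      LinearMap.adjoint (covCurlL2K 𝕜 c₀ c R) (covCurlL2K 𝕜 c₀ c R A - covCurlL2K 𝕜 c₀ c R₁ A) +
        LinearMap.adjoint (covCurlL2K 𝕜 c₀ c R - covCurlL2K 𝕜 c₀ c R₁) (covCurlL2K 𝕜 c₀ c R₁ A) := by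
    rw [map_sub, map_sub, LinearMap.sub_apply]; abel
  have h1 : ∀ y, ‖LinearMap.adjoint (covCurlL2K 𝕜 c₀ c R) y‖ ≤ 4 * Real.sqrt d * ((1 + εR) * ‖c‖) * ‖y‖ :=
    norm_adjoint_apply_le _ (by positivity) (norm_covCurlL2K_le c hεR hR)
  have h2 : ∀ y, ‖LinearMap.adjoint (covCurlL2K 𝕜 c₀ c R - covCurlL2K 𝕜 c₀ c R₁) y‖ ≤ 4 * Real.sqrt d * (‖c‖ * εR) * ‖y‖ :=
    norm_adjoint_apply_le _ (by positivity) fun B => by rw [LinearMap.sub_apply]; exact norm_covCurlL2K_sub_le c hεR hR hR₁ B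
  have h3 := norm_covCurlL2K_sub_le c hεR hR hR₁ A
  have h4 := norm_covCurlL2K_le c le_rfl hR₁' A
  have hd : Real.sqrt d * Real.sqrt d = d := Real.mul_self_sqrt (Nat.cast_nonneg d)
  rw [hsplit]
  calc _ ≤ ‖LinearMap.adjoint (covCurlL2K 𝕜 c₀ c R) (covCurlL2K 𝕜 c₀ c R A - covCurlL2K 𝕜 c₀ c R₁ A)‖ +
        ‖LinearMap.adjoint (covCurlL2K 𝕜 c₀ c R - covCurlL2K 𝕜 c₀ c R₁) (covCurlL2K 𝕜 c₀ c R₁ A)‖ := norm_add_le _ _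
    _ ≤ 4 * Real.sqrt d * ((1 + εR) * ‖c‖) * (4 * Real.sqrt d * (‖c‖ * εR) * ‖A‖) +
        4 * Real.sqrt d * (‖c‖ * εR) * (4 * Real.sqrt d * ((1 + 0) * ‖c‖) * ‖A‖) :=
        add_le_add ((h1 _).trans (mul_le_mul_of_nonneg_left h3 (by positivity))) ((h2 _).trans (mul_le_mul_of_nonneg_left h4 (by positivity)))
    _ = 16 * (Real.sqrt d * Real.sqrt d) * (2 + εR) * ‖c‖ ^ 2 * εR * ‖A‖ := by ring
    _ = 16 * d * (2 + εR) * ‖c‖ ^ 2 * εR * ‖A‖ := by rw [hd]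

/-- **THE BOUND OF `D*_S` (cocurl) ON `L²`**: `‖D*_S G‖ ≤ 4√d·(1 + εR)·‖c‖·‖G‖`. [cite: Balaban1985BackgroundPropagators, (3.9) p.392] -/
theorem norm_covCoCurlL2K_le (hc : conj c = c) (hεR : 0 ≤ εR) (hR : ∀ b w, ‖R b w - w‖ ≤ εR * ‖w‖)
    (hRS : ∀ (b : Bond d Pd) (v u : W), ⟪R b v, u⟫_𝕜 = ⟪v, S b u⟫_𝕜) (G : PlaqL2K 𝕜 d Pd c₀ W) :
    ‖covCoCurlL2K 𝕜 c₀ c S G‖ ≤ 4 * Real.sqrt d * ((1 + εR) * ‖c‖) * ‖G‖ := by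
  rw [← adjoint_covCurlL2K c hc R S hRS]
  exact norm_adjoint_apply_le _ (by positivity) (norm_covCurlL2K_le c hεR hR) G

end Curl


end Literature.MathematicalPhysics.QuantumFieldTheory.Balaban1983to89.B9Eq373DerivativeRemainderL2

end
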